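import Literature.NumberTheory.Transcendental.EllipticPeriodLogSpan
import Literature.NumberTheory.Transcendental.AnalyticSubgroupElliptic
import Literature.NumberTheory.Transcendental.SemistabilityInduction
import Literature.NumberTheory.Transcendental.SemistabilityOneFactor
import Literature.NumberTheory.Transcendental.SchneiderPeriodsProofs
import Literature.NumberTheory.Transcendental.OnePeriodsMasserCMProofs
import Literature.NumberTheory.Transcendental.KontsevichZagierGammaProofs
import HarnessLib

/-!
# A non-zero elliptic period outside the `ℚ̄`-span of `1` and logarithms — proofs

Topic: `Literature/NumberTheory/Transcendental`. A proofs-only sibling (theorems only: no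
definitions, no named facts) of `EllipticPeriodLogSpan.lean`, which vendors the named fact
`Literature.NumberTheory.Transcendental.ellipticPeriod_not_mem_logSpan` (unit
`provefact-Literature.NumberTheory.Transcendental.e-2526aebcd4`): for a period pair `L` with
algebraic invariants, complex multiplication ALLOWED, every non-zero `ω ∈ Λ`, all algebraic
`β₀, …, β_k` and all `y₁, …, y_k` with `e^{yᵢ} ∈ ℚ̄`, `ω ≠ β₀ + ∑ βᵢ yᵢ` (Huber–Wüstholz 2022,
Thm. 15.3 (1) for the 1-motive `[ℤ^r → 𝔾ₘ^r] × [0 → E]`; equivalently Wüstholz's analytic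
subgroup theorem for `𝔾ₐ × 𝔾ₘ^r × E` at `u = (1, y, ω)`). The light statement file deliberately
imports nothing from `Literature/`; this file carries the heavy imports and proves the whole
REDUCTION of the fact to the one transcendence input, following the module docstring of the
statement file, and discharges every part of it that the tree can presently supply:

* `not_mem_logSpan_of_linearIndependent` — **Step 1 (linear algebra).** It suffices to treat
  `ℚ`-linearly independent `y₁, …, y_r` (any finite index type): a maximal `ℚ`-linearly
  independent subfamily of the `yᵢ` (`exists_linearIndependent'`) spans all of them over `ℚ`,
  and substituting turns `ω = β₀ + ∑ βᵢ yᵢ` into a relation of the same shape with algebraic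
  coefficients over the subfamily. (The roots-of-unity bookkeeping of the statement file's
  docstring is not needed: `ℚ`-linear independence of the logarithms themselves is the invariant,
  exactly as in Baker's theorem `Literature.NumberTheory.Transcendental.baker`.)
* `not_mem_logSpan_of_ast_period` — **Step 2 (the transcendence input, for ONE lattice).** If the
  analytic subgroup theorem holds for `G = 𝔾ₐ × 𝔾ₘ^ι × E♮` at the period point
  `u = (x; y; (ω, η(ω)))` in the hyperplane form of
  `Literature.NumberTheory.Transcendental.analyticSubgroupTheorem_GaGmE_periods` with `κ = Fin 1`
  — hypothesis `hast`, stated inline for the lattice at hand, NO assumption on complex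
  multiplication — then `ω ∉ ℚ̄ + ∑ ℚ̄ yⱼ` for `ℚ`-independent `yⱼ`: the relation
  `β₀ · 1 + ∑ βⱼ yⱼ − 1 · ω + 0 · η(ω) = 0` is non-trivial, and the three degenerate alternatives
  are excluded by `1 ≠ 0`, by the `ℚ`-independence of the `yⱼ`, and by `ω ≠ 0`
  (Huber–Wüstholz 2022, proof of Thm. 15.3 (1) via Thm. 6.2; Baker–Wüstholz 2007, §6.1–6.2).
* `ellipticPeriod_not_mem_logSpan_of_ast_period` — Steps 1 + 2: the named fact follows from the
  `κ = Fin 1` period-point analytic subgroup theorem for ALL lattices with algebraic invariants;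
  `ellipticPeriod_not_mem_logSpan_of_hyperplaneTheorem_one` — the same from the hyperplane theorem
  for the quotients of `𝔾ₐ × 𝔾ₘ^ι × E♮` (ONE factor `E♮`) at points with torsion abelian part
  (`LiePresentation.HyperplaneTheorem` for `GaGmE.presTors L ι (Fin 1)`), via the tree's dévissage
  `GaGmE.periods_of_hyperplaneTheorem_presTors` (sorry-free, no CM hypothesis).
* **The case without complex multiplication is thereby reduced to named facts already in the
  tree**: `ellipticPeriod_not_mem_logSpan_of_not_hasCM` (from
  `analyticSubgroupTheorem_GaGmE_periods`), `…_of_not_hasCM_of_analyticSubgroupTheorem` (from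
  `analyticSubgroupTheorem_GaGmE`), and `…_of_not_hasCM_of_philippon` (from Philippon's zero
  estimate `philippon1986_std` ALONE, everything in between — Baker's method on `M_κ`, the
  Semistability Theorem at torsion points, the dévissage — being proved in the tree,
  `analyticSubgroupTheorem_GaGmE_periods_of_philippon`).
* `ellipticPeriod_not_mem_logSpan_of_periods_of_hasCM` — the CM-uniform fact from the non-CM named
  fact plus the `κ = Fin 1` period-point statement for CM lattices (explicit hypothesis).
* `ellipticPeriod_ne_of_isAlgebraic` — the case `k = 0` (non-zero periods are transcendental) is
  UNCONDITIONAL: Schneider 1937, `Literature.NumberTheory.Transcendental.schneider_holds`.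
* `ellipticPeriod_not_mem_logSpan_of_hasCM_of_torsion` — UNCONDITIONAL in the CM case when every
  `e^{yᵢ}` is a root of unity (`yᵢ ∈ ℚ·2πi`): then `ω = c·ω₁` with `c ≠ 0` algebraic
  (`PeriodPair.exists_isAlgebraic_mul_ω₁_of_hasCM`: `ω₂ = ((α − a)/b)·ω₁` for a multiplier
  `αω₁ = aω₁ + bω₂`, `α` imaginary quadratic), and a relation `ω = β₀ + β'·2πi` contradicts
  Masser's Theorem III, `1, 2πi, ω₁, η₁` `ℚ̄`-independent (tree: `masser_ellipticPeriods_cm_holds`,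
  proved from Chudnovsky's theorem).
* `transcendental_pi_div_ellipticPeriod`, `ellipticPeriod_ne_algebraic_mul_pi` — Schneider's
  **`π/ω` is transcendental** (so `ω ∉ ℚ̄·π`: the specialisation
  `ellipticPeriod_not_mem_logSpan.ne_algebraic_mul_pi` of the statement file), UNCONDITIONALLY
  for every lattice with algebraic invariants, CM or not: a non-zero `ω` is `g·ω₀` with `ω₀` the
  first vector of another basis of `Λ` (`PeriodPair.exists_lattice_eq_eq_natCast_mul_ω₁`, Bézout),
  and `π/ω₀` is transcendental by Chudnovsky's theorem (tree:
  `Chudnovsky.Chudnovsky1984_thm_7_2_6_holds`: `π/ω₁`, `η₁/ω₁` algebraically independent).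

* `not_mem_logSpan_of_zeroEstimateAt`, `ellipticPeriod_not_mem_logSpan_of_zeroEstimate_oneFactor`
  — **the whole fact, complex multiplication allowed, from Philippon's zero estimate on the
  `M_κ` with AT MOST ONE elliptic factor** (explicit hypothesis: the body of `philippon1986_std`
  without its `¬ L.HasCM` binder, restricted to `|γ| ≤ 1`, where its obstruction list
  `GaGmE.Std.SubgroupDataC` is complete with or without CM): the closing chain re-threaded for one
  lattice in `SemistabilityOneFactor.lean` (`GaGmE.periods_oneFactor_of_zeroEstimateAt`) feeds
  Step 2; `ellipticPeriod_not_mem_logSpan_of_philippon_of_zeroEstimate_hasCM` — the same with the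
  non-CM lattices served by the named fact `philippon1986_std` and only the CM lattices by the
  one-factor zero estimate.

## What is NOT here, and why (the CM case)

For a lattice WITH complex multiplication no named fact of the tree supplies the hypothesis of
Step 2: `analyticSubgroupTheorem_GaGmE(_periods)`, `semistabilityTheorem_std` and
`philippon1986_std` (and the hyperplane statement `hstd` of `SemistableTorsion.lean` proved from
the latter) all carry `¬ L.HasCM`, because for
`|κ| ≥ 2` the integer data `GaGmE.SubgroupData` no longer list all connected algebraic subgroups
of `(E♮)^κ` (graphs of complex multiplications). For ONE factor `E♮` (`κ = Fin 1`, all that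
`ω` needs) the list `0, 𝔾ₐ, E♮` is complete with or without CM (a connected subgroup of `E♮`
surjecting onto `E` and meeting `𝔾ₐ` trivially would split the universal vectorial extension), so
the hypothesis of `ellipticPeriod_not_mem_logSpan_of_hyperplaneTheorem_one` is a correct instance
of Wüstholz's theorem for every lattice with algebraic invariants (Huber–Wüstholz 2022, Thm. 6.2);
in the tree's chain `philippon1986_std → … → hyperplaneTheorem_presTors` the hypothesis
`¬ L.HasCM` is only ever passed on to Philippon's zero estimate, never used otherwise. The closing
chain is re-threaded for one lattice with at most one elliptic factor in
`SemistabilityOneFactor.lean`; what a discharge of the CM case still needs is exactly Philippon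
1986, Thm. 2.1, for the `M_κ` over a CM lattice with `|γ| ≤ 1` — the hypothesis `hZ` of
`ellipticPeriod_not_mem_logSpan_of_zeroEstimate_oneFactor` (not vendored as a named fact by this
unit, D-0026). Nothing is asserted here: every hypothesis is explicit.

## References

* A. Huber, G. Wüstholz, *Transcendence and Linear Relations of 1-Periods*, Cambridge Tracts in
  Math. 227, CUP 2022: Def. 15.1, Notation 15.2, Thm. 15.3 (p. 148), proof of Thm. 15.3 (§15.4),
  Thm. 18.9 (p. 182: `dim W = 2 + 4/e + …`, Baker periods when points are torsion), Thm. 6.2.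
  [HuberWustholz2022]
* A. Baker, G. Wüstholz, *Logarithmic Forms and Diophantine Geometry*, CUP 2007: Thm. 6.1, §6.1
  (Schneider's theorem and Baker's theorem from the analytic subgroup theorem), §6.2, Thm. 6.15,
  §6.8. [BakerWustholz2007]
* P. Philippon, *Lemmes de zéros dans les groupes algébriques commutatifs*, Bull. Soc. Math.
  France 114 (1986), Thm. 2.1. [Philippon1986]
* Th. Schneider, *Arithmetische Untersuchungen elliptischer Integrale*, Math. Ann. 113 (1937),
  1–13. [Schneider1937]
-/

noncomputable section

open Complex

namespace Literature.NumberTheory.Transcendental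

/-! ### Step 1 — reduction to `ℚ`-linearly independent logarithms -/

/-- **Reduction to `ℚ`-linearly independent logarithms.** If `ω ≠ c₀ + ∑ⱼ cⱼ yⱼ` for every
FINITE `ℚ`-linearly independent family `(yⱼ)` of logarithms of algebraic numbers and all algebraic
`c₀, cⱼ`, then `ω ≠ β₀ + ∑ᵢ βᵢ yᵢ` for arbitrary `y₁, …, y_k` with `e^{yᵢ}` algebraic and algebraic
`βᵢ`: substitute the `ℚ`-expansions of the `yᵢ` in a maximal `ℚ`-linearly independent subfamily.
Pure linear algebra (the transcendence is in the hypothesis `hcore`). [folklore] -/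
theorem not_mem_logSpan_of_linearIndependent {ω : ℂ}
    (hcore : ∀ (ι : Type) [Fintype ι] (y : ι → ℂ), (∀ i, IsAlgebraic ℚ (cexp (y i))) →
      LinearIndependent ℚ y → ∀ (c₀ : ℂ) (c : ι → ℂ), IsAlgebraic ℚ c₀ →
        (∀ i, IsAlgebraic ℚ (c i)) → ω ≠ c₀ + ∑ i, c i * y i)
    (k : ℕ) (β₀ : ℂ) (β y : Fin k → ℂ) (hβ₀ : IsAlgebraic ℚ β₀)
    (hβ : ∀ i, IsAlgebraic ℚ (β i)) (hy : ∀ i, IsAlgebraic ℚ (cexp (y i))) :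
    ω ≠ β₀ + ∑ i, β i * y i := by
  classical
  -- a maximal `ℚ`-linearly independent subfamily `y ∘ a`, `a : κ → Fin k` injective
  obtain ⟨κ, a, ha, hspan, hli⟩ := exists_linearIndependent' ℚ y
  letI : Fintype κ := Fintype.ofInjective a ha
  -- every `y i` is a `ℚ`-linear combination of the `y (a j)`
  have hmem : ∀ i, y i ∈ Submodule.span ℚ (Set.range (y ∘ a)) := fun i => by
    rw [hspan]; exact Submodule.subset_span (Set.mem_range_self i)
  choose q hq using fun i => (Submodule.mem_span_range_iff_exists_fun ℚ).mp (hmem i)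
  have hyq : ∀ i, y i = ∑ j, (q i j : ℂ) * y (a j) := fun i => by
    rw [← hq i]
    simp [Rat.smul_def, Function.comp]
  -- algebraicity of the substituted coefficients `∑ᵢ βᵢ q i j`
  have memK : ∀ c : ℂ, IsAlgebraic ℚ c → c ∈ algebraicClosure ℚ ℂ := fun c hc =>
    mem_algebraicClosure_iff.mpr hc
  have hcoef : ∀ j, IsAlgebraic ℚ (∑ i, β i * (q i j : ℂ)) := fun j => by
    refine mem_algebraicClosure_iff.mp (Subalgebra.sum_mem _ fun i _ => ?_)
    exact mul_mem (memK _ (hβ i)) (memK _ (isAlgebraic_algebraMap (q i j)))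
  intro hω
  refine hcore κ (y ∘ a) (fun j => hy (a j)) hli β₀ (fun j => ∑ i, β i * (q i j : ℂ)) hβ₀
    hcoef ?_
  rw [hω]
  congr 1
  calc ∑ i, β i * y i = ∑ i, ∑ j, β i * (q i j : ℂ) * y (a j) := by
        refine Finset.sum_congr rfl fun i _ => ?_
        rw [hyq i, Finset.mul_sum]
        exact Finset.sum_congr rfl fun j _ => by ring
    _ = ∑ j, (∑ i, β i * (q i j : ℂ)) * (y ∘ a) j := by
        rw [Finset.sum_comm]
        exact Finset.sum_congr rfl fun j _ => by rw [Finset.sum_mul]; rfl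

/-! ### Step 2 — the transcendence input for one lattice -/

/-- **From the analytic subgroup theorem at a period point to the period–logarithm statement, for
one lattice (CM allowed).** Let `ω = mω₁ + nω₂ ≠ 0` and suppose (`hast`) that for
`G = 𝔾ₐ × 𝔾ₘ^ι × E♮` and `u = (x; y; (mω₁ + nω₂, mη₁ + nη₂))` with `x`, `e^{y_i}` algebraic, a
`ℚ̄`-linear dependence of the coordinates of `u` forces `x = 0`, or an integer relation among the
`y_i`, or `a · (mω₁ + nω₂) = 0` with `0 ≠ a ∈ ℤ` — the `κ = Fin 1` instance of the conclusion of
`analyticSubgroupTheorem_GaGmE_periods` for THIS lattice. Then for `ℚ`-linearly independent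
logarithms `yⱼ` of algebraic numbers and algebraic `c₀, cⱼ`, `ω ≠ c₀ + ∑ cⱼ yⱼ`: the relation
`c₀·1 + ∑ cⱼyⱼ − ω + 0·η(ω) = 0` is non-trivial and all three alternatives fail.
[cite: HuberWustholz2022, Thm. 15.3 (1) (proof, §15.4, via Thm. 6.2) for M = [ℤ^r → 𝔾ₘ^r] × [0 → E]] [cite: BakerWustholz2007, §6.1–6.2 (deductions from Thm. 6.1)] -/
theorem not_mem_logSpan_of_ast_period (L : PeriodPair) {ω : ℂ} (hω : ω ∈ L.lattice)
    (hω0 : ω ≠ 0)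
    (hast : ∀ (ι : Type) [Fintype ι] (x : ℂ) (y : ι → ℂ) (m n : Fin 1 → ℤ), IsAlgebraic ℚ x →
      (∀ i, IsAlgebraic ℚ (cexp (y i))) →
      ¬ QbarLinearIndependent
          (lieCoords x y (fun k => (m k : ℂ) * L.ω₁ + (n k : ℂ) * L.ω₂)
            (fun k => (m k : ℂ) * L.η₁ + (n k : ℂ) * L.η₂)) →
        x = 0 ∨ (∃ p : ι → ℤ, p ≠ 0 ∧ ∑ i, (p i : ℂ) * y i = 0) ∨
          (∃ a : Fin 1 → ℤ, a ≠ 0 ∧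
            ∑ k, (a k : ℂ) * ((m k : ℂ) * L.ω₁ + (n k : ℂ) * L.ω₂) = 0))
    (ι : Type) [Fintype ι] (y : ι → ℂ) (hy : ∀ i, IsAlgebraic ℚ (cexp (y i)))
    (hli : LinearIndependent ℚ y) (c₀ : ℂ) (c : ι → ℂ) (hc₀ : IsAlgebraic ℚ c₀)
    (hc : ∀ i, IsAlgebraic ℚ (c i)) : ω ≠ c₀ + ∑ i, c i * y i := by
  classical
  obtain ⟨m, n, hmn⟩ := PeriodPair.mem_lattice.mp hω
  intro hωc
  -- the coefficient family of the relation `c₀·1 + ∑ cⱼ yⱼ − ω + 0·η(ω) = 0`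
  set γ : Unit ⊕ (ι ⊕ (Fin 1 ⊕ Fin 1)) → ℂ := lieCoords c₀ c (fun _ => -1) (fun _ => 0) with hγ
  have hγalg : ∀ s, IsAlgebraic ℚ (γ s) := by
    rintro (_ | i | k | k)
    · simpa [hγ] using hc₀
    · simpa [hγ] using hc i
    · simpa [hγ] using isAlgebraic_one.neg
    · simpa [hγ] using isAlgebraic_zero
  have hdep : ¬ QbarLinearIndependent
      (lieCoords 1 y (fun k => ((fun _ : Fin 1 => m) k : ℂ) * L.ω₁ + ((fun _ : Fin 1 => n) k : ℂ) * L.ω₂)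
        (fun k => ((fun _ : Fin 1 => m) k : ℂ) * L.η₁ + ((fun _ : Fin 1 => n) k : ℂ) * L.η₂)) := by
    intro hQ
    have hsum : ∑ s, γ s * lieCoords 1 y
        (fun k => ((fun _ : Fin 1 => m) k : ℂ) * L.ω₁ + ((fun _ : Fin 1 => n) k : ℂ) * L.ω₂)
        (fun k => ((fun _ : Fin 1 => m) k : ℂ) * L.η₁ + ((fun _ : Fin 1 => n) k : ℂ) * L.η₂) s
        = 0 := by
      simp only [Fintype.sum_sum_type, Finset.univ_unique, Finset.sum_singleton, hγ,
        lieCoords_inl, lieCoords_inr_inl, lieCoords_inr_inr_inl, lieCoords_inr_inr_inr, hmn]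
      linear_combination (-1 : ℂ) * hωc
    have h0 := hQ γ hγalg hsum (Sum.inr (Sum.inr (Sum.inl 0)))
    simp [hγ] at h0
  rcases hast ι 1 y (fun _ => m) (fun _ => n) isAlgebraic_one hy hdep with
    h0 | ⟨p, hp, hpy⟩ | ⟨a, ha, haω⟩
  · exact one_ne_zero h0
  · -- an integer relation among the `yⱼ` contradicts their `ℚ`-independence
    have hliZ : LinearIndependent ℤ y := (LinearIndependent.iff_fractionRing ℤ ℚ).mpr hli
    exact hp (funext fun i =>
      Fintype.linearIndependent_iff.mp hliZ p (by simpa [zsmul_eq_mul] using hpy) i)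
  · -- `a · ω = 0` with `a ≠ 0` contradicts `ω ≠ 0`
    have ha0 : a 0 ≠ 0 := fun h => ha (funext fun k => by
      rw [Subsingleton.elim k 0, h]; rfl)
    have haω' : (a 0 : ℂ) * ω = 0 := by simpa [hmn] using haω
    rcases mul_eq_zero.mp haω' with h | h
    · exact ha0 (by exact_mod_cast h)
    · exact hω0 h

/-! ### The named fact from the `κ = Fin 1` analytic subgroup theorem (all lattices) -/

/-- **`ellipticPeriod_not_mem_logSpan` follows from the analytic subgroup theorem for
`𝔾ₐ × 𝔾ₘ^ι × E♮` at period points (hyperplane form, `κ = Fin 1`), granted for every lattice with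
algebraic invariants, with or without complex multiplication** — the hypothesis `hast` is the body
of `analyticSubgroupTheorem_GaGmE_periods` at `κ = Fin 1` without its `¬ L.HasCM` binder (for one
factor `E♮` the subgroup list behind the hyperplane form is complete in the CM case as well; see
the module docstring). Steps 1 and 2. [cite: HuberWustholz2022, Thm. 15.3 (1) with Thm. 6.2] -/
theorem ellipticPeriod_not_mem_logSpan_of_ast_period
    (hast : ∀ (L : PeriodPair), IsAlgebraic ℚ L.g₂ → IsAlgebraic ℚ L.g₃ →
      ∀ (ι : Type) [Fintype ι] (x : ℂ) (y : ι → ℂ) (m n : Fin 1 → ℤ), IsAlgebraic ℚ x →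
      (∀ i, IsAlgebraic ℚ (cexp (y i))) →
      ¬ QbarLinearIndependent
          (lieCoords x y (fun k => (m k : ℂ) * L.ω₁ + (n k : ℂ) * L.ω₂)
            (fun k => (m k : ℂ) * L.η₁ + (n k : ℂ) * L.η₂)) →
        x = 0 ∨ (∃ p : ι → ℤ, p ≠ 0 ∧ ∑ i, (p i : ℂ) * y i = 0) ∨
          (∃ a : Fin 1 → ℤ, a ≠ 0 ∧
            ∑ k, (a k : ℂ) * ((m k : ℂ) * L.ω₁ + (n k : ℂ) * L.ω₂) = 0)) :
    ellipticPeriod_not_mem_logSpan :=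
  fun L h₂ h₃ _ω hω hω0 k β₀ β y hβ₀ hβ hy =>
    not_mem_logSpan_of_linearIndependent
      (fun ι _ => not_mem_logSpan_of_ast_period L hω hω0 (fun ι _ => hast L h₂ h₃ ι) ι)
      k β₀ β y hβ₀ hβ hy

/-- **`ellipticPeriod_not_mem_logSpan` follows from the hyperplane theorem for the quotients of
`𝔾ₐ × 𝔾ₘ^ι × E♮` (ONE factor `E♮`) at points with torsion abelian part**, for every lattice with
algebraic invariants (`LiePresentation.HyperplaneTheorem` for `GaGmE.presTors L ι (Fin 1)`; the
analytic subgroup theorem, Baker–Wüstholz 2007, Thm. 6.1, for these hyperplanes): the tree's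
dévissage `GaGmE.periods_of_hyperplaneTheorem_presTors` (sorry-free, no CM hypothesis) supplies
`hast`. Without CM this hypothesis is `GaGmE.hyperplaneTheorem_presTors_of_std_tors` applied to
the hyperplane statement for the `M_κ` at points with torsion abelian part, which
`SemistabilityInduction.analyticSubgroupTheorem_std_tors_of_philippon` proves from Philippon's zero
estimate; with CM it is the one missing input (module docstring).
[cite: BakerWustholz2007, Thm. 6.1, §6.8 (Thm. 6.1 from Thm. 6.15)] [cite: HuberWustholz2022, Thm. 15.3 (1)] -/
theorem ellipticPeriod_not_mem_logSpan_of_hyperplaneTheorem_one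
    (hH : ∀ (L : PeriodPair) (h₂ : IsAlgebraic ℚ L.g₂) (h₃ : IsAlgebraic ℚ L.g₃)
      (ι : Type) [Fintype ι], (GaGmE.presTors L ι (Fin 1) h₂ h₃).HyperplaneTheorem) :
    ellipticPeriod_not_mem_logSpan :=
  ellipticPeriod_not_mem_logSpan_of_ast_period fun L h₂ h₃ ι _ x y m n hx hy hdep =>
    GaGmE.periods_of_hyperplaneTheorem_presTors h₂ h₃ (hH L h₂ h₃ ι) x y m n hx hy hdep

/-! ### Without complex multiplication: reduction to named facts of the tree -/

/-- **The non-CM case of `ellipticPeriod_not_mem_logSpan` from the named fact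
`analyticSubgroupTheorem_GaGmE_periods`** (Wüstholz's analytic subgroup theorem for
`𝔾ₐ × 𝔾ₘ^ι × (E♮)^κ` at period vectors, `E` without CM), instance `κ = Fin 1`.
[cite: HuberWustholz2022, Thm. 15.3 (1) for [ℤ^r → 𝔾ₘ^r] × [0 → E], e(E) = 1] [cite: Wustholz1989, the analytic subgroup theorem] -/
theorem ellipticPeriod_not_mem_logSpan_of_not_hasCM (h : analyticSubgroupTheorem_GaGmE_periods)
    (L : PeriodPair) (h₂ : IsAlgebraic ℚ L.g₂) (h₃ : IsAlgebraic ℚ L.g₃) (hCM : ¬ L.HasCM)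
    {ω : ℂ} (hω : ω ∈ L.lattice) (hω0 : ω ≠ 0) (k : ℕ) (β₀ : ℂ) (β y : Fin k → ℂ)
    (hβ₀ : IsAlgebraic ℚ β₀) (hβ : ∀ i, IsAlgebraic ℚ (β i))
    (hy : ∀ i, IsAlgebraic ℚ (cexp (y i))) : ω ≠ β₀ + ∑ i, β i * y i :=
  not_mem_logSpan_of_linearIndependent
    (fun ι _ => not_mem_logSpan_of_ast_period L hω hω0
      (fun ι _ x y m n hx hy' hdep => h L h₂ h₃ hCM ι (Fin 1) x y m n hx hy' hdep) ι)
    k β₀ β y hβ₀ hβ hy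

/-- The non-CM case from the general named fact `analyticSubgroupTheorem_GaGmE` (all algebraic
points of `(E♮)^κ`), through its period instance `analyticSubgroupTheorem_GaGmE.periods`.
[cite: HuberWustholz2022, Thm. 15.3 (1) with Thm. 6.2] -/
theorem ellipticPeriod_not_mem_logSpan_of_not_hasCM_of_analyticSubgroupTheorem
    (h : analyticSubgroupTheorem_GaGmE) (L : PeriodPair) (h₂ : IsAlgebraic ℚ L.g₂)
    (h₃ : IsAlgebraic ℚ L.g₃) (hCM : ¬ L.HasCM) {ω : ℂ} (hω : ω ∈ L.lattice) (hω0 : ω ≠ 0)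
    (k : ℕ) (β₀ : ℂ) (β y : Fin k → ℂ) (hβ₀ : IsAlgebraic ℚ β₀)
    (hβ : ∀ i, IsAlgebraic ℚ (β i)) (hy : ∀ i, IsAlgebraic ℚ (cexp (y i))) :
    ω ≠ β₀ + ∑ i, β i * y i :=
  ellipticPeriod_not_mem_logSpan_of_not_hasCM h.periods L h₂ h₃ hCM hω hω0 k β₀ β y hβ₀ hβ hy

/-- **The non-CM case of `ellipticPeriod_not_mem_logSpan` granted only Philippon's zero estimate
on `M_κ`** (`philippon1986_std`, Philippon 1986, Thm. 2.1): Baker's method on `M_κ`, the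
Semistability Theorem at points with torsion abelian part and the dévissage to the period-point
analytic subgroup theorem are proved in the tree
(`analyticSubgroupTheorem_GaGmE_periods_of_philippon`), and the period point `(1; y; (ω, η(ω)))`
HAS torsion (zero) abelian part. [cite: BakerWustholz2007, Thm. 6.15, §6.8] [cite: Philippon1986, Thm 2.1] [cite: HuberWustholz2022, Thm. 15.3 (1)] -/
theorem ellipticPeriod_not_mem_logSpan_of_not_hasCM_of_philippon (hphil : philippon1986_std)
    (L : PeriodPair) (h₂ : IsAlgebraic ℚ L.g₂) (h₃ : IsAlgebraic ℚ L.g₃) (hCM : ¬ L.HasCM)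
    {ω : ℂ} (hω : ω ∈ L.lattice) (hω0 : ω ≠ 0) (k : ℕ) (β₀ : ℂ) (β y : Fin k → ℂ)
    (hβ₀ : IsAlgebraic ℚ β₀) (hβ : ∀ i, IsAlgebraic ℚ (β i))
    (hy : ∀ i, IsAlgebraic ℚ (cexp (y i))) : ω ≠ β₀ + ∑ i, β i * y i :=
  ellipticPeriod_not_mem_logSpan_of_not_hasCM (analyticSubgroupTheorem_GaGmE_periods_of_philippon
    hphil) L h₂ h₃ hCM hω hω0 k β₀ β y hβ₀ hβ hy

/-- **The CM-uniform named fact from the non-CM named fact plus the CM input.** Granted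
`analyticSubgroupTheorem_GaGmE_periods` (no CM) and, for lattices WITH complex multiplication, the
`κ = Fin 1` period-point analytic subgroup theorem (explicit hypothesis `hCM1`, the one input the
tree does not vendor), `ellipticPeriod_not_mem_logSpan` holds.
[cite: HuberWustholz2022, Thm. 15.3 (1) (e(E) ∈ {1, 2}) with Thm. 6.2] -/
theorem ellipticPeriod_not_mem_logSpan_of_periods_of_hasCM
    (h : analyticSubgroupTheorem_GaGmE_periods)
    (hCM1 : ∀ (L : PeriodPair), IsAlgebraic ℚ L.g₂ → IsAlgebraic ℚ L.g₃ → L.HasCM →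
      ∀ (ι : Type) [Fintype ι] (x : ℂ) (y : ι → ℂ) (m n : Fin 1 → ℤ), IsAlgebraic ℚ x →
      (∀ i, IsAlgebraic ℚ (cexp (y i))) →
      ¬ QbarLinearIndependent
          (lieCoords x y (fun k => (m k : ℂ) * L.ω₁ + (n k : ℂ) * L.ω₂)
            (fun k => (m k : ℂ) * L.η₁ + (n k : ℂ) * L.η₂)) →
        x = 0 ∨ (∃ p : ι → ℤ, p ≠ 0 ∧ ∑ i, (p i : ℂ) * y i = 0) ∨
          (∃ a : Fin 1 → ℤ, a ≠ 0 ∧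
            ∑ k, (a k : ℂ) * ((m k : ℂ) * L.ω₁ + (n k : ℂ) * L.ω₂) = 0)) :
    ellipticPeriod_not_mem_logSpan := by
  refine ellipticPeriod_not_mem_logSpan_of_ast_period fun L h₂ h₃ ι _ x y m n hx hy hdep => ?_
  by_cases hL : L.HasCM
  · exact hCM1 L h₂ h₃ hL ι x y m n hx hy hdep
  · exact h L h₂ h₃ hL ι (Fin 1) x y m n hx hy hdep

/-! ### From Philippon's zero estimate with at most one elliptic factor (CM allowed) -/

/-- **`ω ∉ ℚ̄ + ∑ ℚ̄ log αᵢ` for ONE lattice with algebraic invariants — complex multiplication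
allowed — from Philippon's zero estimate for the `M_κ` over that lattice with at most one
elliptic factor** (hypothesis `hZ`: the body of `philippon1986_std` at `L` for `|γ| ≤ 1`, no CM
hypothesis; for at most one elliptic coordinate the obstruction list `GaGmE.Std.SubgroupDataC` is
the complete list of connected algebraic subgroups of `M_κ` whether or not `E` has CM). Step 1,
and Step 2 fed by `GaGmE.periods_oneFactor_of_zeroEstimateAt` (`SemistabilityOneFactor.lean`:
Baker's method on `M_κ`, the induction over borderline quotients and subgroups with `|γ| ≤ 1`
preserved, the transport to the quotients of `𝔾ₐ × 𝔾ₘ^ι × E♮`, the dévissage at the period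
vector). [cite: HuberWustholz2022, Thm. 15.3 (1) with Thm. 6.2] [cite: BakerWustholz2007, Thm. 6.1, Thm. 6.15, §6.8] [cite: Philippon1986, Thm 2.1] -/
theorem not_mem_logSpan_of_zeroEstimateAt (L : PeriodPair) (h₂ : IsAlgebraic ℚ L.g₂)
    (h₃ : IsAlgebraic ℚ L.g₃)
    (hZ : ∀ (β γ δ : Type) [Fintype β] [Fintype γ] [Fintype δ] [DecidableEq γ]
      (κM : δ → γ → GaGmE.Kbar), Fintype.card γ ≤ 1 →
      ∃ c : ℝ, 0 < c ∧ ∀ (𝔟 : Submodule ℂ (β ⊕ (γ ⊕ δ) → ℂ)) (v : β ⊕ (γ ⊕ δ) → ℂ)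
        (P : MvPolynomial (Option β × GaGmE.Std.ThetaIdx γ δ) ℂ) (D S T : ℕ),
        0 < Module.finrank ℂ 𝔟 → 1 ≤ D → 1 ≤ S → P.IsHomogeneous D →
        (∃ w, GaGmE.Std.thetaEval L κM P w ≠ 0) →
        (∀ s : ℕ, s ≤ Fintype.card (β ⊕ (γ ⊕ δ)) * S →
          GaGmE.Std.VanishesAlong 𝔟 (GaGmE.Std.thetaEval L κM P) ((s : ℂ) • v)
            (Fintype.card (β ⊕ (γ ⊕ δ)) * T + 1)) →
        ∃ K : GaGmE.Std.SubgroupDataC β γ δ κM,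
          (∃ w₀, ∀ w ∈ K.tangent, GaGmE.Std.thetaEval L κM P (w₀ + w) = 0) ∧
          (Nat.choose (T + (Module.finrank ℂ 𝔟 - Module.finrank ℂ ↥(𝔟 ⊓ K.tangent)))
              (Module.finrank ℂ 𝔟 - Module.finrank ℂ ↥(𝔟 ⊓ K.tangent)) : ℝ) *
            (GaGmE.Std.orbitCard L κM K v S : ℝ) * (D : ℝ) ^ Module.finrank ℂ K.tangent ≤
            c * (D : ℝ) ^ Fintype.card (β ⊕ (γ ⊕ δ)))
    {ω : ℂ} (hω : ω ∈ L.lattice) (hω0 : ω ≠ 0) (k : ℕ) (β₀ : ℂ) (β y : Fin k → ℂ)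
    (hβ₀ : IsAlgebraic ℚ β₀) (hβ : ∀ i, IsAlgebraic ℚ (β i))
    (hy : ∀ i, IsAlgebraic ℚ (cexp (y i))) : ω ≠ β₀ + ∑ i, β i * y i :=
  not_mem_logSpan_of_linearIndependent
    (fun ι _ => not_mem_logSpan_of_ast_period L hω hω0
      (fun ι _ x y m n hx hy hdep =>
        GaGmE.periods_oneFactor_of_zeroEstimateAt h₂ h₃ hZ (κ := Fin 1) (by simp) x y m n hx hy hdep) ι)
    k β₀ β y hβ₀ hβ hy

/-- **`ellipticPeriod_not_mem_logSpan` — all lattices with algebraic invariants, with or without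
complex multiplication — follows from Philippon's zero estimate (1986, Thm. 2.1) on the group
varieties `M_κ = 𝔾ₘ^β × P_κ` with AT MOST ONE elliptic factor**, i.e. from the body of the named
fact `philippon1986_std` without its `¬ L.HasCM` binder and restricted to `|γ| ≤ 1` (hypothesis
`hZ`, for which Philippon's printed theorem applies verbatim: with at most one elliptic coordinate
the connected algebraic subgroups of `M_κ` are exactly those listed by `GaGmE.Std.SubgroupDataC`,
CM or not). Everything between this zero estimate and the fact is proved in the tree
(`SemistabilityOneFactor.lean`, Steps 1–2 above); this is the whole remaining transcendence input
of `ellipticPeriod_not_mem_logSpan_holds`.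
[cite: HuberWustholz2022, Thm. 15.3 (1) with Thm. 6.2] [cite: BakerWustholz2007, Thm. 6.1, Thm. 6.15, §6.8] [cite: Philippon1986, Thm 2.1] -/
theorem ellipticPeriod_not_mem_logSpan_of_zeroEstimate_oneFactor
    (hZ : ∀ (L : PeriodPair), IsAlgebraic ℚ L.g₂ → IsAlgebraic ℚ L.g₃ →
      ∀ (β γ δ : Type) [Fintype β] [Fintype γ] [Fintype δ] [DecidableEq γ]
      (κM : δ → γ → GaGmE.Kbar), Fintype.card γ ≤ 1 →
      ∃ c : ℝ, 0 < c ∧ ∀ (𝔟 : Submodule ℂ (β ⊕ (γ ⊕ δ) → ℂ)) (v : β ⊕ (γ ⊕ δ) → ℂ)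
        (P : MvPolynomial (Option β × GaGmE.Std.ThetaIdx γ δ) ℂ) (D S T : ℕ),
        0 < Module.finrank ℂ 𝔟 → 1 ≤ D → 1 ≤ S → P.IsHomogeneous D →
        (∃ w, GaGmE.Std.thetaEval L κM P w ≠ 0) →
        (∀ s : ℕ, s ≤ Fintype.card (β ⊕ (γ ⊕ δ)) * S →
          GaGmE.Std.VanishesAlong 𝔟 (GaGmE.Std.thetaEval L κM P) ((s : ℂ) • v)
            (Fintype.card (β ⊕ (γ ⊕ δ)) * T + 1)) →
        ∃ K : GaGmE.Std.SubgroupDataC β γ δ κM,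
          (∃ w₀, ∀ w ∈ K.tangent, GaGmE.Std.thetaEval L κM P (w₀ + w) = 0) ∧
          (Nat.choose (T + (Module.finrank ℂ 𝔟 - Module.finrank ℂ ↥(𝔟 ⊓ K.tangent)))
              (Module.finrank ℂ 𝔟 - Module.finrank ℂ ↥(𝔟 ⊓ K.tangent)) : ℝ) *
            (GaGmE.Std.orbitCard L κM K v S : ℝ) * (D : ℝ) ^ Module.finrank ℂ K.tangent ≤
            c * (D : ℝ) ^ Fintype.card (β ⊕ (γ ⊕ δ))) :
    ellipticPeriod_not_mem_logSpan :=
  fun L h₂ h₃ _ω hω hω0 k β₀ β y hβ₀ hβ hy =>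
    not_mem_logSpan_of_zeroEstimateAt L h₂ h₃ (hZ L h₂ h₃) hω hω0 k β₀ β y hβ₀ hβ hy

/-- **`ellipticPeriod_not_mem_logSpan` from the named fact `philippon1986_std` (lattices without
CM) together with Philippon's zero estimate for the `M_κ` with at most one elliptic factor over
the lattices WITH complex multiplication** (explicit hypothesis `hZcm`): the discharge
`ellipticPeriod_not_mem_logSpan_holds` is this theorem applied to `philippon1986_std_holds` and
to the CM one-factor zero estimate, once both are in the tree.
[cite: HuberWustholz2022, Thm. 15.3 (1) (e(E) ∈ {1, 2}) with Thm. 6.2] [cite: Philippon1986, Thm 2.1] -/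
theorem ellipticPeriod_not_mem_logSpan_of_philippon_of_zeroEstimate_hasCM (hphil : philippon1986_std)
    (hZcm : ∀ (L : PeriodPair), IsAlgebraic ℚ L.g₂ → IsAlgebraic ℚ L.g₃ → L.HasCM →
      ∀ (β γ δ : Type) [Fintype β] [Fintype γ] [Fintype δ] [DecidableEq γ]
      (κM : δ → γ → GaGmE.Kbar), Fintype.card γ ≤ 1 →
      ∃ c : ℝ, 0 < c ∧ ∀ (𝔟 : Submodule ℂ (β ⊕ (γ ⊕ δ) → ℂ)) (v : β ⊕ (γ ⊕ δ) → ℂ)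
        (P : MvPolynomial (Option β × GaGmE.Std.ThetaIdx γ δ) ℂ) (D S T : ℕ),
        0 < Module.finrank ℂ 𝔟 → 1 ≤ D → 1 ≤ S → P.IsHomogeneous D →
        (∃ w, GaGmE.Std.thetaEval L κM P w ≠ 0) →
        (∀ s : ℕ, s ≤ Fintype.card (β ⊕ (γ ⊕ δ)) * S →
          GaGmE.Std.VanishesAlong 𝔟 (GaGmE.Std.thetaEval L κM P) ((s : ℂ) • v)
            (Fintype.card (β ⊕ (γ ⊕ δ)) * T + 1)) →
        ∃ K : GaGmE.Std.SubgroupDataC β γ δ κM,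
          (∃ w₀, ∀ w ∈ K.tangent, GaGmE.Std.thetaEval L κM P (w₀ + w) = 0) ∧
          (Nat.choose (T + (Module.finrank ℂ 𝔟 - Module.finrank ℂ ↥(𝔟 ⊓ K.tangent)))
              (Module.finrank ℂ 𝔟 - Module.finrank ℂ ↥(𝔟 ⊓ K.tangent)) : ℝ) *
            (GaGmE.Std.orbitCard L κM K v S : ℝ) * (D : ℝ) ^ Module.finrank ℂ K.tangent ≤
            c * (D : ℝ) ^ Fintype.card (β ⊕ (γ ⊕ δ))) :
    ellipticPeriod_not_mem_logSpan := by
  intro L h₂ h₃ ω hω hω0 k β₀ β y hβ₀ hβ hy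
  by_cases hL : L.HasCM
  · exact not_mem_logSpan_of_zeroEstimateAt L h₂ h₃ (hZcm L h₂ h₃ hL) hω hω0 k β₀ β y hβ₀ hβ hy
  · exact ellipticPeriod_not_mem_logSpan_of_not_hasCM_of_philippon hphil L h₂ h₃ hL hω hω0 k β₀ β y
      hβ₀ hβ hy

/-! ### The case `k = 0` is unconditional (Schneider 1937) -/

/-- **The case `k = 0` of `ellipticPeriod_not_mem_logSpan`, unconditionally**: a non-zero period
of a lattice with algebraic invariants is not an algebraic number (Schneider 1937; the tree's
sorry-free `Literature.NumberTheory.Transcendental.schneider_holds`, Baker 1975, Thm. 6.1 / 6.5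
run for `z, ℘, ℘'`). With or without complex multiplication. [cite: Schneider1937, Math. Ann. 113  Satz] -/
theorem ellipticPeriod_ne_of_isAlgebraic (L : PeriodPair) (h₂ : IsAlgebraic ℚ L.g₂)
    (h₃ : IsAlgebraic ℚ L.g₃) {ω : ℂ} (hω : ω ∈ L.lattice) (hω0 : ω ≠ 0) {β₀ : ℂ}
    (hβ₀ : IsAlgebraic ℚ β₀) : ω ≠ β₀ :=
  fun h => schneider_holds L h₂ h₃ hω hω0 (h ▸ hβ₀)

/-- The `k = 0` slice of the named fact in its own binder shape (empty families `β, y`),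
unconditionally. [cite: Schneider1937, Math. Ann. 113  Satz] -/
theorem ellipticPeriod_not_mem_logSpan_zero (L : PeriodPair) (h₂ : IsAlgebraic ℚ L.g₂)
    (h₃ : IsAlgebraic ℚ L.g₃) {ω : ℂ} (hω : ω ∈ L.lattice) (hω0 : ω ≠ 0) (β₀ : ℂ)
    (β y : Fin 0 → ℂ) (hβ₀ : IsAlgebraic ℚ β₀) : ω ≠ β₀ + ∑ i, β i * y i := by
  simpa using ellipticPeriod_ne_of_isAlgebraic L h₂ h₃ hω hω0 hβ₀

/-! ### With complex multiplication and torsion exponentials: unconditional (Masser's Thm. III) -/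

/-- **In the CM case every lattice vector is an algebraic multiple of `ω₁`.** If `αΛ ⊆ Λ` with
`α ∉ ℤ` (`PeriodPair.HasCM`) and `αω₁ = aω₁ + bω₂`, then `b ≠ 0`, `α` is a root of the integer
quadratic `X² − (a + d)X + (ad − bc)` (`PeriodPair.sq_sub_trace_mul_add_det_eq_zero`), and
`ω₂ = ((α − a)/b)·ω₁`; hence `mω₁ + nω₂ = (m + n(α − a)/b)·ω₁` with an algebraic coefficient
(`τ = ω₂/ω₁` is imaginary quadratic). A dot-notation extension of Mathlib's `PeriodPair`,
declared deliberately. [folklore] -/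
theorem _root_.PeriodPair.exists_isAlgebraic_mul_ω₁_of_hasCM (L : PeriodPair) (hCM : L.HasCM)
    {ω : ℂ} (hω : ω ∈ L.lattice) : ∃ c : ℂ, IsAlgebraic ℚ c ∧ ω = c * L.ω₁ := by
  classical
  obtain ⟨α, hαZ, hαΛ⟩ := hCM
  obtain ⟨a, b, hab⟩ := PeriodPair.mem_lattice.mp (hαΛ _ L.ω₁_mem_lattice)
  obtain ⟨c, d, hcd⟩ := PeriodPair.mem_lattice.mp (hαΛ _ L.ω₂_mem_lattice)
  obtain ⟨m, n, hmn⟩ := PeriodPair.mem_lattice.mp hω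
  have hω₁ : L.ω₁ ≠ 0 := L.ω₁_ne_zero
  have hb : b ≠ 0 := by
    rintro rfl
    apply hαZ a
    have h0 : (α - a) * L.ω₁ = 0 := by push_cast at hab; linear_combination -hab
    rcases mul_eq_zero.mp h0 with h | h
    · linear_combination h
    · exact absurd h hω₁
  -- `α` is algebraic (a root of `X² − (a + d)X + (ad − bc)`)
  have hquad := PeriodPair.sq_sub_trace_mul_add_det_eq_zero hab.symm hcd.symm
  have hαK : IsAlgebraic ℚ α := by
    refine ⟨Polynomial.C 1 * Polynomial.X ^ 2 + Polynomial.C (-((a : ℚ) + d)) * Polynomial.X +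
      Polynomial.C ((a : ℚ) * d - b * c), fun h0 => ?_, ?_⟩
    · have hdeg := Polynomial.degree_quadratic (b := -((a : ℚ) + d))
        (c := (a : ℚ) * d - b * c) (one_ne_zero (α := ℚ))
      rw [h0, Polynomial.degree_zero] at hdeg
      exact absurd hdeg (by decide)
    · simp only [map_add, map_mul, map_neg, Polynomial.aeval_X_pow, Polynomial.aeval_C,
        Polynomial.aeval_X, eq_ratCast]
      push_cast
      linear_combination hquad
  -- the coefficient `m + n (α − a)/b`
  have memK : ∀ z : ℂ, IsAlgebraic ℚ z → z ∈ algebraicClosure ℚ ℂ := fun z hz =>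
    mem_algebraicClosure_iff.mpr hz
  refine ⟨m + n * ((α - a) / b), ?_, ?_⟩
  · refine mem_algebraicClosure_iff.mp (add_mem (memK _ (isAlgebraic_int m)) (mul_mem
      (memK _ (isAlgebraic_int n)) (div_mem (sub_mem (memK _ hαK) (memK _ (isAlgebraic_int a)))
        (memK _ (isAlgebraic_int b)))))
  · have hbC : (b : ℂ) ≠ 0 := Int.cast_ne_zero.mpr hb
    have hω₂ : L.ω₂ = (α - a) / b * L.ω₁ := by
      field_simp
      linear_combination hab
    rw [← hmn, hω₂]
    ring

/-- **The CM case of `ellipticPeriod_not_mem_logSpan` for logarithms of roots of unity,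
unconditionally.** If `Λ` has algebraic invariants and complex multiplication, `0 ≠ ω ∈ Λ`, and
every `e^{yᵢ}` is a root of unity (so `yᵢ ∈ ℚ·2πi`), then `ω ≠ β₀ + ∑ βᵢ yᵢ` for algebraic `βᵢ`:
otherwise `ω = c·ω₁` (`PeriodPair.exists_isAlgebraic_mul_ω₁_of_hasCM`, `c ≠ 0` algebraic) gives a
relation `β₀·1 + β'·2πi − c·ω₁ + 0·η₁ = 0`, contradicting Masser's Theorem III (`1, 2πi, ω₁, η₁`
are `ℚ̄`-linearly independent in the CM case; tree: `masser_ellipticPeriods_cm_holds`). The slice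
`[ℤ^r → 𝔾ₘ^r] × [0 → E]` with all `αⱼ` torsion of the Huber–Wüstholz count (`𝒫 = ℚ̄ + ℚ̄·2πi + 𝒫⟨E⟩`,
`e(E) = 2`). [cite: Masser1975, Ch. III §3.1 Thm. III (p. 36)] [cite: HuberWustholz2022, Thm. 15.3 (1) and Thm. 18.9 (e = 2)] -/
theorem ellipticPeriod_not_mem_logSpan_of_hasCM_of_torsion (L : PeriodPair)
    (h₂ : IsAlgebraic ℚ L.g₂) (h₃ : IsAlgebraic ℚ L.g₃) (hCM : L.HasCM) {ω : ℂ}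
    (hω : ω ∈ L.lattice) (hω0 : ω ≠ 0) (k : ℕ) (β₀ : ℂ) (β y : Fin k → ℂ)
    (hβ₀ : IsAlgebraic ℚ β₀) (hβ : ∀ i, IsAlgebraic ℚ (β i))
    (hy : ∀ i, ∃ N : ℕ, 0 < N ∧ cexp (y i) ^ N = 1) : ω ≠ β₀ + ∑ i, β i * y i := by
  classical
  -- `yᵢ = rᵢ · 2πi` with `rᵢ ∈ ℚ`
  choose N hN hroot using hy
  have hk : ∀ i, ∃ n : ℤ, (N i : ℂ) * y i = n * (2 * Real.pi * I) := fun i =>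
    Complex.exp_eq_one_iff.mp (by rw [Complex.exp_nat_mul, hroot i])
  choose n hn using hk
  set r : Fin k → ℚ := fun i => (n i : ℚ) / (N i : ℚ) with hr
  have hyr : ∀ i, y i = (r i : ℂ) * (2 * Real.pi * I) := fun i => by
    have hNi : (N i : ℂ) ≠ 0 := Nat.cast_ne_zero.mpr (hN i).ne'
    rw [hr]
    push_cast
    field_simp
    linear_combination hn i
  -- `ω = c · ω₁`, `c ≠ 0` algebraic
  obtain ⟨c, hcK, hωc⟩ := L.exists_isAlgebraic_mul_ω₁_of_hasCM hCM hω
  have hc0 : c ≠ 0 := by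
    rintro rfl
    exact hω0 (by rw [hωc, zero_mul])
  -- the algebraic coefficient of `2πi`
  have memK : ∀ z : ℂ, IsAlgebraic ℚ z → z ∈ algebraicClosure ℚ ℂ := fun z hz =>
    mem_algebraicClosure_iff.mpr hz
  set βπ : ℂ := ∑ i, β i * (r i : ℂ) with hβπ
  have hβπK : IsAlgebraic ℚ βπ :=
    mem_algebraicClosure_iff.mp (Subalgebra.sum_mem _ fun i _ =>
      mul_mem (memK _ (hβ i)) (memK _ (isAlgebraic_algebraMap (r i))))
  intro hωβ
  have hrel : β₀ + βπ * (2 * Real.pi * I) - c * L.ω₁ = 0 := by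
    have hsum : ∑ i, β i * y i = βπ * (2 * Real.pi * I) := by
      rw [hβπ, Finset.sum_mul]
      exact Finset.sum_congr rfl fun i _ => by rw [hyr i]; ring
    rw [← hωc, ← hsum, hωβ]
    ring
  -- Masser's Theorem III
  have key := masser_ellipticPeriods_cm_holds L h₂ h₃ hCM ![β₀, βπ, -c, 0]
    (fun i => by
      fin_cases i
      · exact hβ₀
      · exact hβπK
      · exact hcK.neg
      · exact isAlgebraic_zero)
    (by
      simp only [Fin.sum_univ_four, Fin.isValue, Matrix.cons_val_zero, Matrix.cons_val_one,
        Matrix.cons_val, mul_one]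
      linear_combination hrel)
  have h2 := key 2
  simp only [Fin.isValue, Matrix.cons_val, neg_eq_zero] at h2
  exact hc0 h2

/-! ### `π/ω` is transcendental (Schneider 1937), unconditionally via Chudnovsky -/

/-- **Every non-zero lattice vector is a positive integer multiple of the first period of some
basis of the same lattice**: `ω = mω₁ + nω₂ = g(a'ω₁ + b'ω₂)` with `g = gcd(m, n) ≥ 1` and
`gcd(a', b') = 1`, and a primitive vector is the first vector of a basis (Bézout,
`PeriodPair.exists_lattice_eq_of_isCoprime`). A dot-notation extension of Mathlib's `PeriodPair`,
declared deliberately. [folklore] -/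
theorem _root_.PeriodPair.exists_lattice_eq_eq_natCast_mul_ω₁ (L : PeriodPair) {ω : ℂ}
    (hω : ω ∈ L.lattice) (hω0 : ω ≠ 0) :
    ∃ (L' : PeriodPair) (g : ℕ), L'.lattice = L.lattice ∧ 0 < g ∧ ω = g * L'.ω₁ := by
  obtain ⟨m, n, hmn⟩ := PeriodPair.mem_lattice.mp hω
  have hgcd0 : 0 < Int.gcd m n := by
    rw [Int.gcd_pos_iff]
    by_contra h0
    push Not at h0
    rw [h0.1, h0.2] at hmn
    simp only [Int.cast_zero, zero_mul, add_zero] at hmn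
    exact hω0 hmn.symm
  obtain ⟨g, a, b, hg, hcop, rfl, rfl⟩ := Int.exists_gcd_one' hgcd0
  have hbez : Int.gcdA a b * a + Int.gcdB a b * b = 1 := by
    have := Int.gcd_eq_gcd_ab a b
    rw [hcop] at this
    push_cast at this
    linarith [this]
  obtain ⟨L', hL', hω₁, -⟩ := L.exists_lattice_eq_of_isCoprime a b _ _ hbez
  refine ⟨L', g, hL', hg, ?_⟩
  rw [hω₁, ← hmn]
  push_cast
  ring

/-- **Schneider 1937: `π/ω` is transcendental** for every non-zero period `ω` of a lattice with
algebraic invariants (complex multiplication allowed) — unconditionally, as a corollary of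
Chudnovsky's theorem proved in the tree (`Chudnovsky.Chudnovsky1984_thm_7_2_6_holds`: `π/ω₁` and
`η₁/ω₁` are algebraically independent for any basis `(ω₁, ω₂)`), applied to a basis whose first
vector `ω₀` has `ω = g·ω₀` (`PeriodPair.exists_lattice_eq_eq_natCast_mul_ω₁`; `g₂, g₃` depend
only on the lattice, `PeriodPair.g₂_eq_of_lattice_eq`): `π/ω₀ = g·(π/ω)`.
[cite: HuberWustholz2022, Prologue ("In particular he showed that π/ω is transcendental")] [cite: Chudnovsky1984, Ch. 7 Thm 2.6 p. 309] -/
theorem transcendental_pi_div_ellipticPeriod (L : PeriodPair) (h₂ : IsAlgebraic ℚ L.g₂)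
    (h₃ : IsAlgebraic ℚ L.g₃) {ω : ℂ} (hω : ω ∈ L.lattice) (hω0 : ω ≠ 0) :
    Transcendental ℚ ((Real.pi : ℂ) / ω) := by
  obtain ⟨L', g, hL', hg, hωg⟩ := L.exists_lattice_eq_eq_natCast_mul_ω₁ hω hω0
  have h₂' : IsAlgebraic ℚ L'.g₂ := by rwa [PeriodPair.g₂_eq_of_lattice_eq hL']
  have h₃' : IsAlgebraic ℚ L'.g₃ := by rwa [PeriodPair.g₃_eq_of_lattice_eq hL']
  have htr : Transcendental ℚ ((Real.pi : ℂ) / L'.ω₁) := by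
    simpa using (Chudnovsky.Chudnovsky1984_thm_7_2_6_holds L' h₂' h₃').transcendental 0
  intro halg
  apply htr
  have hg0 : (g : ℂ) ≠ 0 := Nat.cast_ne_zero.mpr hg.ne'
  have hω₁ : L'.ω₁ = ω / g := by rw [hωg]; field_simp
  have e : (Real.pi : ℂ) / L'.ω₁ = (g : ℂ) * ((Real.pi : ℂ) / ω) := by
    rw [hω₁]; field_simp
  rw [e]
  exact (isAlgebraic_nat g).mul halg

/-- **`ω ∉ ℚ̄·π`, unconditionally** (the specialisation
`ellipticPeriod_not_mem_logSpan.ne_algebraic_mul_pi` of the statement file, without its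
hypothesis): for a lattice with algebraic invariants, `0 ≠ ω ∈ Λ` and algebraic `β`, `ω ≠ β·π` —
otherwise `π/ω = β⁻¹` would be algebraic. [cite: HuberWustholz2022, Prologue (Schneider 1937: π/ω transcendental)] [cite: Chudnovsky1984, Ch. 7 Thm 2.6 p. 309] -/
theorem ellipticPeriod_ne_algebraic_mul_pi (L : PeriodPair) (h₂ : IsAlgebraic ℚ L.g₂)
    (h₃ : IsAlgebraic ℚ L.g₃) {ω : ℂ} (hω : ω ∈ L.lattice) (hω0 : ω ≠ 0) {β : ℂ}
    (hβ : IsAlgebraic ℚ β) : ω ≠ β * Real.pi := by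
  intro hωβ
  have hπ : (Real.pi : ℂ) ≠ 0 := by exact_mod_cast Real.pi_ne_zero
  have hβ0 : β ≠ 0 := by
    rintro rfl
    exact hω0 (by rw [hωβ, zero_mul])
  apply transcendental_pi_div_ellipticPeriod L h₂ h₃ hω hω0
  have e : (Real.pi : ℂ) / ω = β⁻¹ := by
    rw [hωβ]; field_simp
  rw [e]
  exact hβ.inv

end Literature.NumberTheory.Transcendental

end
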